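import Summits.Parity.GeneralizedHardyLittlewood.Theorems.FordMaynardSieveConst01651SieveConst01651BuchstabCert
import HarnessLib

/-!
# Route `FordMaynardSieveConst01651`, target `SieveConst01651` (stmt-Parity-19185), stub `stub_certValuePos` (R2):
# KERNEL EVALUATION of the certificate checker — `certCheck = true`

Def-free helper file.  The checker `certCheck` of `…BuchstabCert` (the Volterra table of `…BuchstabTable`, five
generations of `19812` cells; `certU1` over `40188` cells; the packed block tables; `9630` grid rectangles of the `1370`
`g₂` cells with tangent/chord brackets) is evaluated by the KERNEL (`decide +kernel`, standard axioms, no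
`native_decide`; ≈ 100 s).  Bit-exact Python mirror: `certU1 = 4143106431398`, `certPsiOne = 2639561389868`,
`certP = 415193824639`, `certN = 8871468962`; the inequality `certU1 + certN < D + certPsiOne + certP` holds with margin
`0.00208·D` (`D = 2⁴⁰`; true `V(ν₀, coneCert) = 0.0027065`).

References: [FordMaynard2024PrimeSieves] arXiv:2407.14368, Theorem 7.3 (a), §8.2.
-/

namespace Summit.Parity.GeneralizedHardyLittlewood.FordMaynardSieveConst01651SieveConst01651

/-- **The certificate check passes** (kernel evaluation): `certU1 + certN < tabD + certPsiOne + certP`. [folklore] -/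
theorem certCheck_eq_true : certCheck = true := by decide +kernel

/-- The certified integer inequality behind `0 < V(ν₀, coneCert)`. [folklore] -/
theorem cert_ineq : certU1 + certN < tabD + certPsiOne + certP := by
  have h := certCheck_eq_true
  unfold certCheck at h
  exact of_decide_eq_true h

end Summit.Parity.GeneralizedHardyLittlewood.FordMaynardSieveConst01651SieveConst01651
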